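import Literature.Algebra.EuclideanLattices.MRGapCVPWitnessCond
import Literature.Probability.Distributions.IndepProductLawMeasure
import Literature.Probability.Distributions.BindExpectation
import Literature.Probability.Distributions.BindLintegral
import HarnessLib

/-!
# MR07 Thm. 5.23, eqs. (16)–(18) for the conditional law of a `W`-run, in summation form — proved

Topic `Algebra/EuclideanLattices` (family `pqc`). Theorems only. The per-condition bounds of
`MRGapCVPWitnessCond.lean` are stated as Bochner integrals / measures of the law
`condLaw … 0 c̄ = ⨂ᵢ D_{Λ,s,ĉᵢ}`; the transfer to the conditional witness law (`MRGapCVPWitnessLaw`)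
consumes them as sums `∑_y condLaw(y) f(output)`. This file performs the conversion:

* `MicciancioRegev2007.integrable_toMeasure_of_abs_le` — bounded functions are integrable under a `PMF`;
* `tsum_condLaw_toReal_mul_cos_output_le` — eq. (16) as a sum (dual lattice);
* `tsum_condLaw_toReal_mul_indicator_output_le` — eq. (17) as a sum;
* `integrable_inner_output_sq` — `y ↦ ⟨u, x − ∑ zᵢyᵢ⟩²` is integrable under `⨂ᵢ D_{Λ,s,ĉᵢ}`
  (Lemma 4.2: square-integrable marginals); `tsum_condLaw_mul_ofReal_inner_output_sq_le` — eq. (18)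
  as a sum in `ℝ≥0∞`; `tsum_condLaw_mul_enorm_output_sq_le` — hence
  `∑_y condLaw(y) ‖x − ∑ zᵢyᵢ‖² ≤ n (2sβ)²` (Parseval over an orthonormal basis).

## References

* D. Micciancio, O. Regev, *Worst-case to average-case reductions based on Gaussian measures*,
  SIAM J. Comput. 37 (2007) 267–302; authors' version, proof of Thm. 5.23, eqs. (16)–(18), pp. 30–31.
-/

noncomputable section

open MeasureTheory ProbabilityTheory Module Metric Finset Submodule PMF
open scoped Real InnerProductSpace ENNReal Classical

namespace Literature.Algebra.EuclideanLattices

namespace MicciancioRegev2007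

open Literature.Probability.Distributions

variable {V : Type*} [NormedAddCommGroup V] [InnerProductSpace ℝ V] [FiniteDimensional ℝ V]
  [MeasurableSpace V] [BorelSpace V]
variable {n : ℕ} (b : Basis (Fin n) ℝ V) (q d : ℕ)
variable (Λ : Submodule ℤ V) [DiscreteTopology Λ] [IsZLattice ℝ Λ]
variable (rep : (Fin n → ZMod (q * d)) ⧸ gridImage b (q * d) Λ → span ℤ (Set.range b))
variable {m : ℕ}

/-! ### Bounded functions under a `PMF` -/

/-- A bounded function is integrable under (the measure of) a `PMF`. [folklore] -/
theorem integrable_toMeasure_of_abs_le {α : Type*} [MeasurableSpace α] [MeasurableSingletonClass α]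
    [Countable α] (p : PMF α) {f : α → ℝ} {M : ℝ} (hf : ∀ a, |f a| ≤ M) :
    Integrable f p.toMeasure :=
  Integrable.of_bound (measurable_of_countable f).aestronglyMeasurable M
    (ae_of_all _ fun a => by rw [Real.norm_eq_abs]; exact hf a)

/-- The expectation of a bounded function under a `PMF`, as a sum. [folklore] -/
theorem integral_toMeasure_eq_tsum_of_abs_le {α : Type*} [MeasurableSpace α]
    [MeasurableSingletonClass α] [Countable α] (p : PMF α) {f : α → ℝ} {M : ℝ} (hf : ∀ a, |f a| ≤ M) :
    ∫ a, f a ∂p.toMeasure = ∑' a, (p a).toReal * f a := by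
  rw [PMF.integral_eq_tsum p f (integrable_toMeasure_of_abs_le p hf)]
  rfl

/-! ### Eq. (16) and eq. (17) as sums -/

/-- **Eq. (16) as a sum** (dual lattice, `n ≥ 2`, `0 < g < λ₁(L)`, `s = 2√n/g`, `zⱼ ≠ 0`,
`dist(−zⱼt, L) > g`): `∑_y condLaw(y) cos(2π⟨t, x − ∑ zᵢyᵢ⟩) ≤ 2·2⁻ⁿ`.
[cite: MicciancioRegev2007, Thm. 5.23 (proof, p. 30, eq. (16))] -/
theorem tsum_condLaw_toReal_mul_cos_output_le (L : Submodule ℤ V) [DiscreteTopology L] [IsZLattice ℝ L]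
    (repD : (Fin n → ZMod (q * d)) ⧸ gridImage b (q * d) (dualLattice L) → span ℤ (Set.range b))
    (hn : 2 ≤ finrank ℝ V) {g : ℝ} (hg : 0 < g) (hgL : g < minNorm L)
    (cbar : Fin m → (Fin n → ZMod (q * d)) ⧸ gridImage b (q * d) (dualLattice L)) (x t : V)
    {z : Fin m → ℤ} {j : Fin m} (hzj : z j ≠ 0)
    (hfar : g < infDist (((-z j : ℤ) : ℝ) • t) (L : Set V)) :
    ∑' y, ((condLaw b q d (dualLattice L) repD (2 * Real.sqrt (finrank ℝ V) / g) (fun _ => (0 : V))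
        cbar) y).toReal *
      Real.cos (2 * π * ⟪t, x - ∑ i, (z i : ℝ) • ((y i : dualLattice L) : V)⟫_ℝ) ≤
      2 * (2⁻¹ : ℝ) ^ finrank ℝ V := by
  rw [← integral_toMeasure_eq_tsum_of_abs_le _ (M := 1) (fun y => Real.abs_cos_le_one _)]
  exact integral_condLaw_cos_output_le b q d L repD hn hg hgL cbar x t hzj hfar

/-- **Eq. (17) as a sum** (`0 < ε < 1`, `0 < s`, `η_ε(Λ) ≤ s`, `∑ zᵢ² ≤ β²`, `nm ≥ 1`,
`‖x − ∑ zᵢĉᵢ‖ < sβ`): `∑_y condLaw(y) 𝟙[√(nm)·2sβ ≤ ‖x − ∑ zᵢyᵢ‖] ≤ m(1+ε)/(1−ε)2⁻ⁿ`.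
[cite: MicciancioRegev2007, Thm. 5.23 (proof, p. 31, eq. (17))] -/
theorem tsum_condLaw_toReal_mul_indicator_output_le {ε s β : ℝ} (hε : 0 < ε) (hε1 : ε < 1)
    (hs : 0 < s) (hηs : smoothingParameter Λ ε ≤ s)
    (cbar : Fin m → (Fin n → ZMod (q * d)) ⧸ gridImage b (q * d) Λ) (x : V) {z : Fin m → ℤ}
    (hz : ∑ i, (z i : ℝ) ^ 2 ≤ β ^ 2) (hnm : 1 ≤ finrank ℝ V * m)
    (hx : ‖x - ∑ i, (z i : ℝ) • (rep (cbar i) : V)‖ < s * β) :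
    ∑' y, ((condLaw b q d Λ rep s (fun _ => (0 : V)) cbar) y).toReal *
      (if Real.sqrt (finrank ℝ V * m) * (2 * s * β) ≤ ‖x - ∑ i, (z i : ℝ) • ((y i : Λ) : V)‖
        then (1 : ℝ) else 0) ≤
      m * ((1 + ε) / (1 - ε) * (2⁻¹ : ℝ) ^ finrank ℝ V) := by
  have h := toReal_condLaw_le_norm_output_le b q d Λ rep hε hε1 hs hηs cbar x hz hnm hx
  rw [toReal_toOuterMeasure_apply] at h
  refine le_of_eq_of_le (tsum_congr fun y => ?_) h
  simp only [Set.indicator_apply, Set.mem_setOf_eq]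
  split_ifs <;> simp

/-! ### Eq. (18) as a sum in `ℝ≥0∞`, and the second moment of the norm -/

/-- **Square integrability of `⟨u, x − ∑ zᵢyᵢ⟩` under `⨂ᵢ D_{Λ,s,ĉᵢ}`** (`0 < s`; Lemma 4.2: the
one-dimensional marginals of `D_{Λ,s,c}` are square integrable).
[cite: MicciancioRegev2007, Lemma 4.2 / Thm. 5.23 (proof, p. 31)] -/
theorem integrable_inner_output_sq {s : ℝ} (hs : 0 < s) (c : Fin m → V) (x u : V) (z : Fin m → ℤ) :
    Integrable (fun y : Fin m → Λ => ⟪u, x - ∑ i, (z i : ℝ) • ((y i : Λ) : V)⟫_ℝ ^ 2)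
      (indepLaw m fun i => discreteGaussian Λ s (c i)).toMeasure := by
  set P := (indepLaw m fun i => discreteGaussian Λ s (c i)).toMeasure with hP
  set p : Fin m → PMF Λ := fun i => discreteGaussian Λ s (c i) with hp
  set v : Fin m → (Fin m → Λ) → ℝ := fun i y => ⟪((y i : Λ) : V) - c i, u⟫_ℝ with hv
  have hvL2 : ∀ i, MemLp (v i) 2 P := fun i => by
    have h := memLp_two_inner_coe_sub Λ hs (c i) u
    have hy : HasLaw (fun y : Fin m → Λ => y i) (p i).toMeasure P := hasLaw_eval_indepLaw m p i
    rw [← hy.map_eq] at h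
    exact h.comp_of_map hy.aemeasurable
  have hsumL2 : MemLp (fun y => ∑ i, (z i : ℝ) • v i y) 2 P :=
    memLp_finsetSum _ fun i _ => (hvL2 i).const_smul (z i : ℝ)
  have hint2 : Integrable (fun y => ‖∑ i, (z i : ℝ) • v i y‖ ^ 2) P :=
    (memLp_two_iff_integrable_sq_norm hsumL2.aestronglyMeasurable).1 hsumL2
  set e : V := x - ∑ i, (z i : ℝ) • c i with he
  have hint_rhs : Integrable (fun y => 2 * (‖u‖ ^ 2 * ‖e‖ ^ 2) + 2 * ‖∑ i, (z i : ℝ) • v i y‖ ^ 2) P :=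
    (integrable_const _).add (hint2.const_mul 2)
  have hpt : ∀ y : Fin m → Λ, ⟪u, x - ∑ i, (z i : ℝ) • ((y i : Λ) : V)⟫_ℝ ^ 2 ≤
      2 * (‖u‖ ^ 2 * ‖e‖ ^ 2) + 2 * ‖∑ i, (z i : ℝ) • v i y‖ ^ 2 := fun y => by
    have hsplit : ⟪u, x - ∑ i, (z i : ℝ) • ((y i : Λ) : V)⟫_ℝ = ⟪u, e⟫_ℝ - ∑ i, (z i : ℝ) • v i y := by
      rw [sub_sum_smul_eq x c (fun i => ((y i : Λ) : V)) z, inner_witness_eq]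
      simp only [hv, he, smul_eq_mul, real_inner_comm u]
    have hue : |⟪u, e⟫_ℝ| ≤ ‖u‖ * ‖e‖ := abs_real_inner_le_norm u e
    have h1 : ⟪u, e⟫_ℝ ^ 2 ≤ ‖u‖ ^ 2 * ‖e‖ ^ 2 := by
      rw [← sq_abs, ← mul_pow]
      exact pow_le_pow_left₀ (abs_nonneg _) hue 2
    rw [hsplit, Real.norm_eq_abs, sq_abs]
    nlinarith [sq_nonneg (⟪u, e⟫_ℝ + ∑ i, (z i : ℝ) • v i y)]
  refine hint_rhs.mono' (measurable_of_countable _).aestronglyMeasurable (ae_of_all _ fun y => ?_)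
  rw [Real.norm_eq_abs, abs_of_nonneg (sq_nonneg _)]
  exact hpt y

/-- **Eq. (18) as a sum in `ℝ≥0∞`** (`2η_ε(Λ) ≤ s`, `‖x − ∑ zᵢĉᵢ‖ ≤ sβ`, `∑ zᵢ² ≤ β²`, side condition
`≤ 1`, unit `u`): `∑_y condLaw(y) ⟨u, x − ∑ zᵢyᵢ⟩² ≤ (2sβ)²`.
[cite: MicciancioRegev2007, Thm. 5.23 (proof, p. 31, eq. (18))] -/
theorem tsum_condLaw_mul_ofReal_inner_output_sq_le {ε s β : ℝ} (hε : 0 < ε) (hε1 : ε < 1)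
    (hs : 0 < s) (hηs : 2 * smoothingParameter Λ ε ≤ s)
    (cbar : Fin m → (Fin n → ZMod (q * d)) ⧸ gridImage b (q * d) Λ) (x : V) {z : Fin m → ℤ}
    (hz : ∑ i, (z i : ℝ) ^ 2 ≤ β ^ 2) (hnum : 1 / (2 * π) + ε / (1 - ε) + (ε / (1 - ε)) ^ 2 * m ≤ 1)
    {u : V} (hu : ‖u‖ = 1) (hx : ‖x - ∑ i, (z i : ℝ) • (rep (cbar i) : V)‖ ≤ s * β) :
    ∑' y, (condLaw b q d Λ rep s (fun _ => (0 : V)) cbar) y *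
        ENNReal.ofReal (⟪u, x - ∑ i, (z i : ℝ) • ((y i : Λ) : V)⟫_ℝ ^ 2) ≤
      ENNReal.ofReal ((2 * s * β) ^ 2) := by
  have hint : Integrable (fun y : Fin m → Λ => ⟪u, x - ∑ i, (z i : ℝ) • ((y i : Λ) : V)⟫_ℝ ^ 2)
      (condLaw b q d Λ rep s (fun _ => (0 : V)) cbar).toMeasure := by
    rw [condLaw_zero]
    exact integrable_inner_output_sq Λ hs _ x u z
  rw [← lintegral_toMeasure_eq_tsum, ← ofReal_integral_eq_lintegral_ofReal hint
    (ae_of_all _ fun y => sq_nonneg _)]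
  exact ENNReal.ofReal_le_ofReal
    (integral_condLaw_inner_output_sq_le b q d Λ rep hε hε1 hs hηs cbar x hz hnum hu hx)

/-- **The second moment of the norm** (same hypotheses): `∑_y condLaw(y) ‖x − ∑ zᵢyᵢ‖² ≤ n (2sβ)²`
(Parseval over an orthonormal basis and eq. (18) in each of the `n` directions).
[cite: MicciancioRegev2007, Thm. 5.23 (proof, p. 31, eq. (18))] -/
theorem tsum_condLaw_mul_enorm_output_sq_le {ε s β : ℝ} (hε : 0 < ε) (hε1 : ε < 1)
    (hs : 0 < s) (hηs : 2 * smoothingParameter Λ ε ≤ s)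
    (cbar : Fin m → (Fin n → ZMod (q * d)) ⧸ gridImage b (q * d) Λ) (x : V) {z : Fin m → ℤ}
    (hz : ∑ i, (z i : ℝ) ^ 2 ≤ β ^ 2) (hnum : 1 / (2 * π) + ε / (1 - ε) + (ε / (1 - ε)) ^ 2 * m ≤ 1)
    (hx : ‖x - ∑ i, (z i : ℝ) • (rep (cbar i) : V)‖ ≤ s * β) :
    ∑' y, (condLaw b q d Λ rep s (fun _ => (0 : V)) cbar) y *
        ‖x - ∑ i, (z i : ℝ) • ((y i : Λ) : V)‖ₑ ^ 2 ≤
      finrank ℝ V * ENNReal.ofReal ((2 * s * β) ^ 2) := by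
  set ob := stdOrthonormalBasis ℝ V with hob
  have hsq : ∀ w : V, (‖w‖ₑ : ℝ≥0∞) ^ 2 = ∑ k, ENNReal.ofReal (⟪ob k, w⟫_ℝ ^ 2) := fun w => by
    rw [← ofReal_norm, ← ENNReal.ofReal_pow (norm_nonneg _), ← ob.sum_sq_inner_right w,
      ENNReal.ofReal_sum_of_nonneg fun k _ => sq_nonneg _]
  simp_rw [hsq, Finset.mul_sum]
  rw [Summable.tsum_finsetSum (fun _ _ => ENNReal.summable)]
  calc ∑ k, ∑' y, (condLaw b q d Λ rep s (fun _ => (0 : V)) cbar) y *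
        ENNReal.ofReal (⟪ob k, x - ∑ i, (z i : ℝ) • ((y i : Λ) : V)⟫_ℝ ^ 2)
      ≤ ∑ _k : Fin (finrank ℝ V), ENNReal.ofReal ((2 * s * β) ^ 2) :=
        Finset.sum_le_sum fun k _ =>
          tsum_condLaw_mul_ofReal_inner_output_sq_le b q d Λ rep hε hε1 hs hηs cbar x hz hnum
            (ob.orthonormal.1 k) hx
    _ = finrank ℝ V * ENNReal.ofReal ((2 * s * β) ^ 2) := by
        rw [Finset.sum_const, Finset.card_univ, Fintype.card_fin, nsmul_eq_mul]

end MicciancioRegev2007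

end Literature.Algebra.EuclideanLattices

end
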